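import Summits.PneNP.PneNP.Theses.AperiodicTorus
import Summits.PneNP.PneNP.Theorems.ExpanderLinearGeneratorsDepthSevenCompleteness
import Summits.PneNP.PneNP.Theorems.AperiodicTorusFregeHardGivesFregeNotPolyBounded
import Literature.Dynamics.Tilings.TorusCNFBandRefutation
import Literature.Dynamics.Tilings.KariBand

/-!
# PneNP / AperiodicTorus — `DepthFregeEasyAperiodicTorus` (item stmt-PneNP-2471): the
Kari–Culik tile set is aperiodic AND its torus tautologies are easy for bounded-depth Frege

Route `PneNP/AperiodicTorus`, item stmt-PneNP-2471 (card S3/D3, "rigid ⇒ easy"): there is an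
aperiodic Wang tile set (tiles the plane, tiles no torus) whose torus tautologies `torusForm n`
have depth-`d` `textbookFrege` proofs of size `≤ n^c`, for fixed `d, c` and every `n ≥ 2`.

Witness: the tree's Kari-type multiplication tile set (`Kari.tileset`, aperiodic by
`isAperiodic_kari`), re-indexed to a colour table `Fin t → ℕ⁴`. The proofs (`d = 17`):
* for `n ≥ 16`, the cyclic band of the first `m + 1 = ⌊log₂ 3n⌋ + 2 ≤ n` rows admits no tiling
  (`KariBand.not_isBandTiling_kari`: `2^m > 3n`), so the band refutation
  `TorusBand.exists_isDepthProofOf_torusForm` (dynamic programming over the `t^(m+1) = poly(n)`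
  column states, written as a local clause refutation and simulated in depth `17`) gives a proof
  of size `≤ n^8739` (`size_bound`; the exponent is an artefact of the crude estimates
  `t ≤ 2^13`, `2^t ≤ n^t`);
* for `2 ≤ n < 16`, any depth-`17` refutation (`exists_isDepthProofOf_neg_ofCNF_of_seven_le`), the
  finitely many sizes being absorbed into the exponent.

References: J. Kari, Discrete Math. 160 (1996); E. Jeandel, P. Vanier, LNM 2273 (2020), §5.3;
J. Krajíček, *Proof complexity*, CUP 2019, §5.4 (bounded-width refutations).
-/

set_option linter.dupNamespace false -- `Summit.PneNP.PneNP.…`: summit = sub-problem (D-0017)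

namespace Summit.PneNP.PneNP.Theorems

namespace AperiodicTorusEasy

open Literature.Dynamics.Tilings Literature.Computability.Complexity
open Literature.Computability.MetaComplexity
open Literature.Barriers.AtomisticToContinuum.WangLatticeGas

/-! ### Arithmetic -/

/-- `3n < 2^(n-2)` for `n ≥ 16`. [folklore] -/
theorem three_mul_lt_two_pow {n : ℕ} (hn : 16 ≤ n) : 3 * n < 2 ^ (n - 2) := by
  induction n, hn using Nat.le_induction with
  | base => norm_num
  | succ n hn ih =>
    have e : n + 1 - 2 = (n - 2) + 1 := by omega
    rw [e, pow_succ]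
    have : 3 ≤ 2 ^ (n - 2) := by
      calc 3 ≤ 2 ^ 2 := by norm_num
        _ ≤ 2 ^ (n - 2) := Nat.pow_le_pow_right (by norm_num) (by omega)
    omega

/-- The band height `⌊log₂ 3n⌋ + 2` fits into the torus for `n ≥ 16`. [folklore] -/
theorem log_bound {n : ℕ} (hn : 16 ≤ n) : Nat.log 2 (3 * n) + 2 < n := by
  have h := Nat.log_lt_of_lt_pow' (b := 2) (by omega : n - 2 ≠ 0) (three_mul_lt_two_pow hn)
  omega

/-- `2^(⌊log₂ 3n⌋ + 2) ≤ 12 n` (`n ≥ 1`). [folklore] -/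
theorem two_pow_log_le {n : ℕ} (hn : 1 ≤ n) : 2 ^ (Nat.log 2 (3 * n) + 2) ≤ 12 * n := by
  rw [pow_add]
  have := Nat.pow_log_le_self 2 (by omega : 3 * n ≠ 0)
  omega

set_option exponentiation.threshold 16384 in
/-- **The size bound.** For `n ≥ 16`, `1 ≤ t ≤ 2^13`, `m + 1 = ⌊log₂ 3n⌋ + 2` and
`L ≤ n²(1 + 3t²)`, the size bound of `TorusBand.exists_isDepthProofOf_torusForm` is `≤ n^8739`.
[folklore] -/
theorem size_bound {n m t L : ℕ} (hn : 16 ≤ n) (ht : t ≤ 2 ^ 13)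
    (hm : m + 1 = Nat.log 2 (3 * n) + 2) (hL : L ≤ n * n * (1 + 3 * (t * t))) :
    2 ^ (3 * (m + 1) + t + 27) *
        (L + (n + 1) * ((m + 1) * ((t + 1) * t ^ (3 * (m + 1)))) + (3 * (m + 1) + t) +
          (3 * (m + 1) + t) + 2) ^ 6 ≤ n ^ 8739 := by
  have hn1 : 1 ≤ n := by omega
  have hn2 : 2 ≤ n := by omega
  have hkn : m + 1 < n := by rw [hm]; exact log_bound hn
  have h2k : 2 ^ (m + 1) ≤ n ^ 2 := by
    rw [hm]
    refine (two_pow_log_le hn1).trans ?_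
    rw [pow_two]; nlinarith
  -- the power of two
  have hA1 : 2 ^ (3 * (m + 1)) ≤ n ^ 6 := by
    rw [pow_mul, show (6 : ℕ) = 2 * 3 by norm_num, pow_mul]
    calc (2 ^ 3) ^ (m + 1) = (2 ^ (m + 1)) ^ 3 := by rw [← pow_mul, ← pow_mul, mul_comm]
      _ ≤ (n ^ 2) ^ 3 := Nat.pow_le_pow_left h2k 3
  have ht' : t ≤ 8192 := ht.trans (by norm_num)
  have hA2 : 2 ^ t ≤ n ^ 8192 :=
    (Nat.pow_le_pow_left hn2 t).trans (Nat.pow_le_pow_right hn1 ht')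
  have hA3 : 2 ^ 27 ≤ n ^ 7 := by
    calc 2 ^ 27 ≤ 16 ^ 7 := by norm_num
      _ ≤ n ^ 7 := Nat.pow_le_pow_left hn 7
  have hA : 2 ^ (3 * (m + 1) + t + 27) ≤ n ^ 8205 := by
    rw [pow_add, pow_add, show (8205 : ℕ) = 6 + 8192 + 7 by norm_num, pow_add, pow_add]
    exact Nat.mul_le_mul (Nat.mul_le_mul hA1 hA2) hA3
  -- the base
  have hB1 : L ≤ n ^ 9 := by
    refine hL.trans ?_
    have h1 : 1 + 3 * (t * t) ≤ n ^ 7 := by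
      have : t * t ≤ 2 ^ 13 * 2 ^ 13 := Nat.mul_le_mul ht ht
      calc 1 + 3 * (t * t) ≤ 2 ^ 28 := by omega
        _ = 16 ^ 7 := by norm_num
        _ ≤ n ^ 7 := Nat.pow_le_pow_left hn 7
    have h2 : n * n ≤ n ^ 2 := by rw [pow_two]
    rw [show (9 : ℕ) = 2 + 7 by norm_num, pow_add]
    exact Nat.mul_le_mul h2 h1
  have hB2 : n + 1 ≤ n ^ 2 := by rw [pow_two]; nlinarith
  have hB3 : m + 1 ≤ n ^ 1 := by rw [pow_one]; exact hkn.le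
  have hB4 : t + 1 ≤ n ^ 4 := by
    calc t + 1 ≤ 2 ^ 16 := by omega
      _ = 16 ^ 4 := by norm_num
      _ ≤ n ^ 4 := Nat.pow_le_pow_left hn 4
  have hB5 : t ^ (3 * (m + 1)) ≤ n ^ 78 := by
    calc t ^ (3 * (m + 1)) ≤ (2 ^ 13) ^ (3 * (m + 1)) := Nat.pow_le_pow_left ht _
      _ = (2 ^ (m + 1)) ^ 39 := by rw [← pow_mul, ← pow_mul]; congr 1; ring
      _ ≤ (n ^ 2) ^ 39 := Nat.pow_le_pow_left h2k 39
      _ = n ^ 78 := by rw [← pow_mul]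
  have hB6 : (n + 1) * ((m + 1) * ((t + 1) * t ^ (3 * (m + 1)))) ≤ n ^ 85 := by
    rw [show (85 : ℕ) = 2 + (1 + (4 + 78)) by norm_num, pow_add, pow_add, pow_add]
    exact Nat.mul_le_mul hB2 (Nat.mul_le_mul hB3 (Nat.mul_le_mul hB4 hB5))
  have hB7 : 3 * (m + 1) + t ≤ n ^ 5 := by
    have h1 : 3 * (m + 1) ≤ n ^ 4 := by
      calc 3 * (m + 1) ≤ n * n := by nlinarith
        _ = n ^ 2 := (pow_two n).symm
        _ ≤ n ^ 4 := Nat.pow_le_pow_right hn1 (by norm_num)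
    have h2 : t ≤ n ^ 4 := by have := hB4; omega
    exact KrajicekRamsey.add_le_pow hn2 h1 h2
  have hB8 : 2 ≤ n ^ 5 := KrajicekRamsey.le_pow_of_le_pow hn1 (by simpa using hn2 : 2 ≤ n ^ 1) (by norm_num)
  have hB : L + (n + 1) * ((m + 1) * ((t + 1) * t ^ (3 * (m + 1)))) + (3 * (m + 1) + t) + (3 * (m + 1) + t) + 2 ≤ n ^ 89 := by
    have s1 := KrajicekRamsey.add_le_pow hn2 (KrajicekRamsey.le_pow_of_le_pow hn1 hB1 (by norm_num : 9 ≤ 85)) hB6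
    have s2 := KrajicekRamsey.add_le_pow hn2 s1 (KrajicekRamsey.le_pow_of_le_pow hn1 hB7 (by norm_num : 5 ≤ 86))
    have s3 := KrajicekRamsey.add_le_pow hn2 s2 (KrajicekRamsey.le_pow_of_le_pow hn1 hB7 (by norm_num : 5 ≤ 87))
    exact KrajicekRamsey.add_le_pow hn2 s3 (KrajicekRamsey.le_pow_of_le_pow hn1 hB8 (by norm_num : 5 ≤ 88))
  have hB' := Nat.pow_le_pow_left hB 6
  rw [← pow_mul] at hB'
  calc _ ≤ n ^ 8205 * n ^ (89 * 6) := Nat.mul_le_mul hA hB'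
    _ = n ^ 8739 := by rw [← pow_add]

/-! ### The tile set -/

/-- The Kari-type tile set has at most `2^13` tiles (crudely: all of `WangTile Col`, `|Col| = 9`).
[folklore] -/
theorem card_tileset_le : Fintype.card Kari.tileset ≤ 2 ^ 13 := by
  have h1 : Fintype.card Kari.tileset ≤ Fintype.card (WangTile Kari.Col) :=
    Fintype.card_le_of_injective _ Subtype.val_injective
  have h2 : Fintype.card (WangTile Kari.Col) = Fintype.card (Kari.Col × Kari.Col × Kari.Col × Kari.Col) :=
    Fintype.card_congr (wangTileEquiv Kari.Col).symm
  have h3 : Fintype.card Kari.Col = 9 := by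
    rw [Fintype.card_coe]; rfl
  rw [h2] at h1
  simp only [Fintype.card_prod, h3] at h1
  omega

/-- The number of clauses of the torus CNF of a colour table: `≤ n²(1 + 3t²)`. [folklore] -/
theorem length_torusCNF_ofNESW_le {t : ℕ} (τ : Fin t → ℕ × ℕ × ℕ × ℕ) (n : ℕ) :
    ((WangTileSet.ofNESW τ).torusCNF n).length ≤ n * n * (1 + 3 * (t * t)) := by
  rw [WangTileSet.torusCNF_ofNESW]
  dsimp only
  refine (torusCNF_length_le τ (fun i j s => (i.1 * n + j.1) * t + s.1)
    (fun i => ⟨(i.1 + 1) % n, Nat.mod_lt _ i.pos⟩)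
    ((List.finRange n).flatMap fun i => (List.finRange n).map fun j => (i, j))
    ((List.finRange t).flatMap fun s => (List.finRange t).map fun s' => (s, s'))).trans ?_
  have h1 : ((List.finRange n).flatMap fun i => (List.finRange n).map fun j => (i, j)).length = n * n := by
    simp [List.length_flatMap]
  have h2 : ((List.finRange t).flatMap fun s => (List.finRange t).map fun s' => (s, s')).length = t * t := by
    simp [List.length_flatMap]
  rw [h1, h2]

end AperiodicTorusEasy

open Literature.Dynamics.Tilings Literature.Computability.Complexity
open Literature.Computability.MetaComplexity
open Literature.Barriers.AtomisticToContinuum.WangLatticeGas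
open AperiodicTorusEasy

set_option exponentiation.threshold 16384 in
/-- **Item stmt-PneNP-2471 (`DepthFregeEasyAperiodicTorus`).** There is an aperiodic Wang tile set,
given by a colour table `τ : Fin t → ℕ⁴` — it tiles the plane and no `n × n` torus, `n ≥ 1` — whose
torus tautologies have depth-`17` `textbookFrege` proofs of size `≤ n^c` for one exponent `c`
and every `n ≥ 2`: the Kari–Culik multiplication tile set, refuted on every torus through an
untileable band of `⌊log₂ 3n⌋ + 2` rows by dynamic programming inside bounded-depth Frege.
[folklore] -/
theorem aperiodicTorus_depthFregeEasyAperiodicTorus_proof :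
    Summit.PneNP.PneNP.Theses.AperiodicTorus.DepthFregeEasyAperiodicTorus := by
  classical
  -- the tile set, re-indexed to `Fin t` with colours in `ℕ`
  set t : ℕ := Fintype.card Kari.tileset with ht
  let e : Kari.tileset ≃ Fin t := Fintype.equivFin _
  obtain ⟨gc, hgc⟩ := Countable.exists_injective_nat Kari.Col
  let T₂ : WangTileSet (Fin t) ℕ := ((WangTileSet.ofFinset Kari.tileset).map gc).reindex e.symm
  have hT : WangTileSet.ofNESW T₂.toNESW = T₂ := WangTileSet.ofNESW_toNESW _
  have hap : T₂.IsAperiodic :=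
    (WangTileSet.isAperiodic_reindex_iff _ e.symm).2
      ((WangTileSet.isAperiodic_map_iff _ hgc).2 WangTileSet.isAperiodic_kari)
  have htle : t ≤ 2 ^ 13 := card_tileset_le
  -- depth-17 refutations for every `n ≥ 1` (used for the small `n`)
  have hsmall : ∀ n, 1 ≤ n → ∃ π, textbookFrege.IsDepthProofOf 17 π (T₂.torusForm n) := by
    intro n hn
    have hunsat : ¬ (T₂.torusCNF n).Satisfiable := fun h =>
      hap.2 n hn ((WangTileSet.torusCNF_satisfiable_iff T₂ n).1 h)
    exact exists_isDepthProofOf_neg_ofCNF_of_seven_le hunsat (by norm_num)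
  choose! πs hπs using hsmall
  set S : ℕ := ∑ n ∈ Finset.range 16, proofSize (πs n) with hS
  refine ⟨t, T₂.toNESW, ?_⟩
  intro tilesTorus torusCNF torusForm
  refine ⟨?_, ?_, 17, 8739 + S, fun n hn => ?_⟩
  · show (WangTileSet.ofNESW T₂.toNESW).TilesPlane
    rw [hT]; exact hap.1
  · show ∀ n ≥ 1, ¬ (WangTileSet.ofNESW T₂.toNESW).TilesTorus n
    rw [hT]; exact hap.2
  · show ∃ π, textbookFrege.IsDepthProofOf 17 π ((WangTileSet.ofNESW T₂.toNESW).torusForm n) ∧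
      proofSize π ≤ n ^ (8739 + S)
    rw [hT]
    have hn1 : 1 ≤ n := by omega
    by_cases hbig : 16 ≤ n
    · -- the band refutation
      set m : ℕ := Nat.log 2 (3 * n) + 1 with hm
      have hmn : m < n := by have := log_bound hbig; omega
      have h3n : 3 * n < 2 ^ m := Nat.lt_pow_succ_log_self (by norm_num) _
      obtain ⟨f, hf⟩ := hap.1
      have ht0 : 0 < t := Fin.pos (f 0 0)
      have hno : ¬ ∃ g : ℤ → ℕ → Fin t, T₂.IsBandTiling n m g := by
        rintro ⟨g, hg⟩
        exact KariBand.not_isBandTiling_kari hn1 h3n _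
          ((WangTileSet.IsBandTiling.of_reindex hg).of_map hgc)
      obtain ⟨π, hπ, hsize⟩ := TorusBand.exists_isDepthProofOf_torusForm T₂ ht0 (by omega) hmn hno
      refine ⟨π, hπ, hsize.trans ?_⟩
      have hL : (T₂.torusCNF n).length ≤ n * n * (1 + 3 * (t * t)) := by
        rw [← hT]; exact length_torusCNF_ofNESW_le _ n
      exact (size_bound hbig htle (by rw [hm]) hL).trans (Nat.pow_le_pow_right hn1 (Nat.le_add_right _ _))
    · -- small `n`: the chosen refutation, its size absorbed into the exponent
      refine ⟨πs n, hπs n hn1, ?_⟩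
      have h1 : proofSize (πs n) ≤ S := by
        rw [hS]
        exact Finset.single_le_sum (f := fun n => proofSize (πs n)) (fun _ _ => Nat.zero_le _)
          (Finset.mem_range.2 (by omega))
      calc proofSize (πs n) ≤ S := h1
        _ ≤ 8739 + S := Nat.le_add_left _ _
        _ ≤ 2 ^ (8739 + S) := (Nat.lt_two_pow_self).le
        _ ≤ n ^ (8739 + S) := Nat.pow_le_pow_left (by omega) _

end Summit.PneNP.PneNP.Theorems
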